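import Literature.NumberTheory.Automorphic.ArchUnitarityBoundsGL2Real
import HarnessLib

/-!
# Unitarity bound at the real places of `GL₂(K_∞)`, weight one: `re κ = 0`
# (Knapp (1986), Ch. XVI §1; Jacquet–Langlands (1970), §5 Thm. 5.13)

Topic `NumberTheory/Automorphic`; namespace `Literature.NumberTheory.Automorphic`. Theorems only (no
definition, no named fact, no instance). Supplement to `ArchUnitarityBoundsGL2Real` (whose current tree version
stops at the weight-zero bounds): for a weight-ONE vector `v` of a unitary representation with central scalar `μ`
and Casimir scalar `λ`, `⟪L v, L v⟫ = -(2λ - μ² + 1) ⟪v, v⟫` (`inner_lowering_self_weightOne`: `L* = -R` by the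
skew-symmetry of `τ(X)`, and `R L v = (2λ - μ² + 1) v`), hence the weight-one parameter `κ` of the symmetrised
weight-one shape type (`(2κ)² = 2λ - μ² + 1`, `RealWeightOneSym`) is PURELY IMAGINARY
(`re_weightOneParam_eq_zero`): the odd principal series of `GL₂(ℝ)` have no complementary series, and the Bessel
index `i(κ - ½)` of the weight-one Kirillov functions has imaginary part exactly `-½` — the input `re κ = 0` of the
Rankin–Selberg Gamma bookkeeping (`ArchRankinSelbergGammaTaggedGL2`).

## References

* A. W. Knapp, *Representation Theory of Semisimple Groups* (1986), Ch. XVI §1 Thm. 16.2 [Knapp1986].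
* H. Jacquet, R. P. Langlands, *Automorphic Forms on GL(2)*, LNM 114 (1970), §5 Thm. 5.13 [JacquetLanglands1970].
-/

noncomputable section

open MeasureTheory Measure NumberField NumberField.InfinitePlace NumberField.mixedEmbedding IsDedekindDomain Set Filter
open scoped MatrixGroups Topology Classical InnerProductSpace ComplexConjugate

namespace Literature.NumberTheory.Automorphic

variable {K : Type} [Field K] [NumberField K]

-- as in `ArchGardingWhittaker`
set_option backward.isDefEq.respectTransparency false

section RealPlace

variable {hcpt : isCompact_glFiniteIntegralLevel 2 K}
  {E : Type*} [NormedAddCommGroup E] [InnerProductSpace ℂ E] [CompleteSpace E]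
  {τ : ContRepresentation ℂ (AutomorphyDatum.gl 2 K hcpt).arch.carrier E}
  (hτ : τ.IsStronglyContinuous) (w : {w : InfinitePlace K // IsReal w})

/-! ### 4. Weight one: `re κ = 0` (odd principal series have no complementary series) -/

/-- **`⟪L v, L v⟫ = -(2λ - μ² + 1) ⟪v, v⟫ for a weight-one vector** (`L* = -R` by skew-symmetry and
`R L v = (2λ - μ² - 1 + 2) v`). [cite: Knapp1986, Ch. XVI §1] -/
theorem inner_lowering_self_weightOne (hτu : τ.IsUnitary) (μ lam : ℂ) (v : archGardingSpace hcpt τ)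
    (hW : gardingEnd hτ ((Matrix.single (0 : Fin 2) (1 : Fin 2) ((Pi.single w 1, 0) : mixedSpace K)) - (Matrix.single (1 : Fin 2) (0 : Fin 2) ((Pi.single w 1, 0) : mixedSpace K))) v = Complex.I • v)
    (hZ : gardingEnd hτ (Matrix.single (0 : Fin 2) (0 : Fin 2) ((Pi.single w 1, 0) : mixedSpace K)) v + gardingEnd hτ (Matrix.single (1 : Fin 2) (1 : Fin 2) ((Pi.single w 1, 0) : mixedSpace K)) v = μ • v)
    (hC : (∑ i : Fin 2, ∑ j : Fin 2, gardingEnd hτ (Matrix.single i j ((Pi.single w 1, 0) : mixedSpace K)) (gardingEnd hτ (Matrix.single j i ((Pi.single w 1, 0) : mixedSpace K)) v)) = lam • v) :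
    ⟪(((gardingEnd hτ ((Matrix.single (0 : Fin 2) (0 : Fin 2) ((Pi.single w 1, 0) : mixedSpace K)) - (Matrix.single (1 : Fin 2) (1 : Fin 2) ((Pi.single w 1, 0) : mixedSpace K)))
        - Complex.I • gardingEnd hτ ((Matrix.single (0 : Fin 2) (1 : Fin 2) ((Pi.single w 1, 0) : mixedSpace K)) + (Matrix.single (1 : Fin 2) (0 : Fin 2) ((Pi.single w 1, 0) : mixedSpace K)))) v : archGardingSpace hcpt τ) : E), (((gardingEnd hτ ((Matrix.single (0 : Fin 2) (0 : Fin 2) ((Pi.single w 1, 0) : mixedSpace K)) - (Matrix.single (1 : Fin 2) (1 : Fin 2) ((Pi.single w 1, 0) : mixedSpace K)))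
        - Complex.I • gardingEnd hτ ((Matrix.single (0 : Fin 2) (1 : Fin 2) ((Pi.single w 1, 0) : mixedSpace K)) + (Matrix.single (1 : Fin 2) (0 : Fin 2) ((Pi.single w 1, 0) : mixedSpace K)))) v : archGardingSpace hcpt τ) : E)⟫_ℂ =
      -(2 * lam - μ ^ 2 + 1) * ⟪(v : E), (v : E)⟫_ℂ := by
  have hW1 : gardingEnd hτ ((Matrix.single (0 : Fin 2) (1 : Fin 2) ((Pi.single w 1, 0) : mixedSpace K)) - (Matrix.single (1 : Fin 2) (0 : Fin 2) ((Pi.single w 1, 0) : mixedSpace K))) v = (Complex.I * 1) • v := by rw [mul_one]; exact hW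
  have hRL : (gardingEnd hτ ((Matrix.single (0 : Fin 2) (0 : Fin 2) ((Pi.single w 1, 0) : mixedSpace K)) - (Matrix.single (1 : Fin 2) (1 : Fin 2) ((Pi.single w 1, 0) : mixedSpace K)))
        + Complex.I • gardingEnd hτ ((Matrix.single (0 : Fin 2) (1 : Fin 2) ((Pi.single w 1, 0) : mixedSpace K)) + (Matrix.single (1 : Fin 2) (0 : Fin 2) ((Pi.single w 1, 0) : mixedSpace K)))) ((gardingEnd hτ ((Matrix.single (0 : Fin 2) (0 : Fin 2) ((Pi.single w 1, 0) : mixedSpace K)) - (Matrix.single (1 : Fin 2) (1 : Fin 2) ((Pi.single w 1, 0) : mixedSpace K)))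
        - Complex.I • gardingEnd hτ ((Matrix.single (0 : Fin 2) (1 : Fin 2) ((Pi.single w 1, 0) : mixedSpace K)) + (Matrix.single (1 : Fin 2) (0 : Fin 2) ((Pi.single w 1, 0) : mixedSpace K)))) v) = (2 * lam - μ ^ 2 + 1) • v := by
    rw [raising_lowering_apply hτ w 1 μ lam v hW1 hZ hC]
    congr 1
    ring
  have hcoe : (((gardingEnd hτ ((Matrix.single (0 : Fin 2) (0 : Fin 2) ((Pi.single w 1, 0) : mixedSpace K)) - (Matrix.single (1 : Fin 2) (1 : Fin 2) ((Pi.single w 1, 0) : mixedSpace K)))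
        - Complex.I • gardingEnd hτ ((Matrix.single (0 : Fin 2) (1 : Fin 2) ((Pi.single w 1, 0) : mixedSpace K)) + (Matrix.single (1 : Fin 2) (0 : Fin 2) ((Pi.single w 1, 0) : mixedSpace K)))) v : archGardingSpace hcpt τ) : E) =
      ((gardingEnd hτ ((Matrix.single (0 : Fin 2) (0 : Fin 2) ((Pi.single w 1, 0) : mixedSpace K)) - (Matrix.single (1 : Fin 2) (1 : Fin 2) ((Pi.single w 1, 0) : mixedSpace K))) v : archGardingSpace hcpt τ) : E)
        - Complex.I • ((gardingEnd hτ ((Matrix.single (0 : Fin 2) (1 : Fin 2) ((Pi.single w 1, 0) : mixedSpace K)) + (Matrix.single (1 : Fin 2) (0 : Fin 2) ((Pi.single w 1, 0) : mixedSpace K))) v : archGardingSpace hcpt τ) : E) := by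
    rw [LinearMap.sub_apply, LinearMap.smul_apply, Submodule.coe_sub, Submodule.coe_smul]
  have hRa : (((gardingEnd hτ ((Matrix.single (0 : Fin 2) (0 : Fin 2) ((Pi.single w 1, 0) : mixedSpace K)) - (Matrix.single (1 : Fin 2) (1 : Fin 2) ((Pi.single w 1, 0) : mixedSpace K)))
        + Complex.I • gardingEnd hτ ((Matrix.single (0 : Fin 2) (1 : Fin 2) ((Pi.single w 1, 0) : mixedSpace K)) + (Matrix.single (1 : Fin 2) (0 : Fin 2) ((Pi.single w 1, 0) : mixedSpace K)))) ((gardingEnd hτ ((Matrix.single (0 : Fin 2) (0 : Fin 2) ((Pi.single w 1, 0) : mixedSpace K)) - (Matrix.single (1 : Fin 2) (1 : Fin 2) ((Pi.single w 1, 0) : mixedSpace K)))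
        - Complex.I • gardingEnd hτ ((Matrix.single (0 : Fin 2) (1 : Fin 2) ((Pi.single w 1, 0) : mixedSpace K)) + (Matrix.single (1 : Fin 2) (0 : Fin 2) ((Pi.single w 1, 0) : mixedSpace K)))) v) : archGardingSpace hcpt τ) : E) =
      ((gardingEnd hτ ((Matrix.single (0 : Fin 2) (0 : Fin 2) ((Pi.single w 1, 0) : mixedSpace K)) - (Matrix.single (1 : Fin 2) (1 : Fin 2) ((Pi.single w 1, 0) : mixedSpace K))) ((gardingEnd hτ ((Matrix.single (0 : Fin 2) (0 : Fin 2) ((Pi.single w 1, 0) : mixedSpace K)) - (Matrix.single (1 : Fin 2) (1 : Fin 2) ((Pi.single w 1, 0) : mixedSpace K)))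
        - Complex.I • gardingEnd hτ ((Matrix.single (0 : Fin 2) (1 : Fin 2) ((Pi.single w 1, 0) : mixedSpace K)) + (Matrix.single (1 : Fin 2) (0 : Fin 2) ((Pi.single w 1, 0) : mixedSpace K)))) v) : archGardingSpace hcpt τ) : E)
        + Complex.I • ((gardingEnd hτ ((Matrix.single (0 : Fin 2) (1 : Fin 2) ((Pi.single w 1, 0) : mixedSpace K)) + (Matrix.single (1 : Fin 2) (0 : Fin 2) ((Pi.single w 1, 0) : mixedSpace K))) ((gardingEnd hτ ((Matrix.single (0 : Fin 2) (0 : Fin 2) ((Pi.single w 1, 0) : mixedSpace K)) - (Matrix.single (1 : Fin 2) (1 : Fin 2) ((Pi.single w 1, 0) : mixedSpace K)))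
        - Complex.I • gardingEnd hτ ((Matrix.single (0 : Fin 2) (1 : Fin 2) ((Pi.single w 1, 0) : mixedSpace K)) + (Matrix.single (1 : Fin 2) (0 : Fin 2) ((Pi.single w 1, 0) : mixedSpace K)))) v) : archGardingSpace hcpt τ) : E) := by
    rw [LinearMap.add_apply, LinearMap.smul_apply, Submodule.coe_add, Submodule.coe_smul]
  have h1 := inner_gardingEnd_eq_neg hτ hτu ((Matrix.single (0 : Fin 2) (0 : Fin 2) ((Pi.single w 1, 0) : mixedSpace K)) - (Matrix.single (1 : Fin 2) (1 : Fin 2) ((Pi.single w 1, 0) : mixedSpace K))) v ((gardingEnd hτ ((Matrix.single (0 : Fin 2) (0 : Fin 2) ((Pi.single w 1, 0) : mixedSpace K)) - (Matrix.single (1 : Fin 2) (1 : Fin 2) ((Pi.single w 1, 0) : mixedSpace K)))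
        - Complex.I • gardingEnd hτ ((Matrix.single (0 : Fin 2) (1 : Fin 2) ((Pi.single w 1, 0) : mixedSpace K)) + (Matrix.single (1 : Fin 2) (0 : Fin 2) ((Pi.single w 1, 0) : mixedSpace K)))) v)
  have h2 := inner_gardingEnd_eq_neg hτ hτu ((Matrix.single (0 : Fin 2) (1 : Fin 2) ((Pi.single w 1, 0) : mixedSpace K)) + (Matrix.single (1 : Fin 2) (0 : Fin 2) ((Pi.single w 1, 0) : mixedSpace K))) v ((gardingEnd hτ ((Matrix.single (0 : Fin 2) (0 : Fin 2) ((Pi.single w 1, 0) : mixedSpace K)) - (Matrix.single (1 : Fin 2) (1 : Fin 2) ((Pi.single w 1, 0) : mixedSpace K)))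
        - Complex.I • gardingEnd hτ ((Matrix.single (0 : Fin 2) (1 : Fin 2) ((Pi.single w 1, 0) : mixedSpace K)) + (Matrix.single (1 : Fin 2) (0 : Fin 2) ((Pi.single w 1, 0) : mixedSpace K)))) v)
  have key : ⟪(v : E), (((gardingEnd hτ ((Matrix.single (0 : Fin 2) (0 : Fin 2) ((Pi.single w 1, 0) : mixedSpace K)) - (Matrix.single (1 : Fin 2) (1 : Fin 2) ((Pi.single w 1, 0) : mixedSpace K)))
        + Complex.I • gardingEnd hτ ((Matrix.single (0 : Fin 2) (1 : Fin 2) ((Pi.single w 1, 0) : mixedSpace K)) + (Matrix.single (1 : Fin 2) (0 : Fin 2) ((Pi.single w 1, 0) : mixedSpace K)))) ((gardingEnd hτ ((Matrix.single (0 : Fin 2) (0 : Fin 2) ((Pi.single w 1, 0) : mixedSpace K)) - (Matrix.single (1 : Fin 2) (1 : Fin 2) ((Pi.single w 1, 0) : mixedSpace K)))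
        - Complex.I • gardingEnd hτ ((Matrix.single (0 : Fin 2) (1 : Fin 2) ((Pi.single w 1, 0) : mixedSpace K)) + (Matrix.single (1 : Fin 2) (0 : Fin 2) ((Pi.single w 1, 0) : mixedSpace K)))) v) : archGardingSpace hcpt τ) : E)⟫_ℂ = (2 * lam - μ ^ 2 + 1) * ⟪(v : E), (v : E)⟫_ℂ := by
    rw [hRL, Submodule.coe_smul, inner_smul_right]
  have e1 : ⟪(((gardingEnd hτ ((Matrix.single (0 : Fin 2) (0 : Fin 2) ((Pi.single w 1, 0) : mixedSpace K)) - (Matrix.single (1 : Fin 2) (1 : Fin 2) ((Pi.single w 1, 0) : mixedSpace K)))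
        - Complex.I • gardingEnd hτ ((Matrix.single (0 : Fin 2) (1 : Fin 2) ((Pi.single w 1, 0) : mixedSpace K)) + (Matrix.single (1 : Fin 2) (0 : Fin 2) ((Pi.single w 1, 0) : mixedSpace K)))) v : archGardingSpace hcpt τ) : E), (((gardingEnd hτ ((Matrix.single (0 : Fin 2) (0 : Fin 2) ((Pi.single w 1, 0) : mixedSpace K)) - (Matrix.single (1 : Fin 2) (1 : Fin 2) ((Pi.single w 1, 0) : mixedSpace K)))
        - Complex.I • gardingEnd hτ ((Matrix.single (0 : Fin 2) (1 : Fin 2) ((Pi.single w 1, 0) : mixedSpace K)) + (Matrix.single (1 : Fin 2) (0 : Fin 2) ((Pi.single w 1, 0) : mixedSpace K)))) v : archGardingSpace hcpt τ) : E)⟫_ℂ =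
      ⟪((gardingEnd hτ ((Matrix.single (0 : Fin 2) (0 : Fin 2) ((Pi.single w 1, 0) : mixedSpace K)) - (Matrix.single (1 : Fin 2) (1 : Fin 2) ((Pi.single w 1, 0) : mixedSpace K))) v : archGardingSpace hcpt τ) : E)
        - Complex.I • ((gardingEnd hτ ((Matrix.single (0 : Fin 2) (1 : Fin 2) ((Pi.single w 1, 0) : mixedSpace K)) + (Matrix.single (1 : Fin 2) (0 : Fin 2) ((Pi.single w 1, 0) : mixedSpace K))) v : archGardingSpace hcpt τ) : E),
        (((gardingEnd hτ ((Matrix.single (0 : Fin 2) (0 : Fin 2) ((Pi.single w 1, 0) : mixedSpace K)) - (Matrix.single (1 : Fin 2) (1 : Fin 2) ((Pi.single w 1, 0) : mixedSpace K)))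
        - Complex.I • gardingEnd hτ ((Matrix.single (0 : Fin 2) (1 : Fin 2) ((Pi.single w 1, 0) : mixedSpace K)) + (Matrix.single (1 : Fin 2) (0 : Fin 2) ((Pi.single w 1, 0) : mixedSpace K)))) v : archGardingSpace hcpt τ) : E)⟫_ℂ :=
    congrArg (fun x : E => ⟪x, (((gardingEnd hτ ((Matrix.single (0 : Fin 2) (0 : Fin 2) ((Pi.single w 1, 0) : mixedSpace K)) - (Matrix.single (1 : Fin 2) (1 : Fin 2) ((Pi.single w 1, 0) : mixedSpace K)))
        - Complex.I • gardingEnd hτ ((Matrix.single (0 : Fin 2) (1 : Fin 2) ((Pi.single w 1, 0) : mixedSpace K)) + (Matrix.single (1 : Fin 2) (0 : Fin 2) ((Pi.single w 1, 0) : mixedSpace K)))) v : archGardingSpace hcpt τ) : E)⟫_ℂ) hcoe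
  rw [e1, inner_sub_left, inner_smul_left, h1, h2, Complex.conj_I]
  rw [hRa, inner_add_right, inner_smul_right] at key
  linear_combination -key

/-- **The weight-one parameter `κ` of a unitary representation is purely imaginary** (`(2κ)² = 2λ - μ² + 1`
is real `≤ 0` on a non-zero weight-one vector): the odd principal series of `GL₂(ℝ)` have no complementary
series, and the Bessel index `i(κ - ½)` of the weight-one Kirillov functions (`ArchKirillovWeightOneGL2Real`)
has imaginary part exactly `-½`. [cite: Knapp1986, Ch. XVI §1, Thm. 16.2] [cite: JacquetLanglands1970, §5 Thm. 5.13] -/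
theorem re_weightOneParam_eq_zero (hτu : τ.IsUnitary) (μ lam κ : ℂ) (hκ : (2 * κ) ^ 2 = 2 * lam - μ ^ 2 + 1)
    {v : archGardingSpace hcpt τ} (hv0 : v ≠ 0)
    (hW : gardingEnd hτ ((Matrix.single (0 : Fin 2) (1 : Fin 2) ((Pi.single w 1, 0) : mixedSpace K)) - (Matrix.single (1 : Fin 2) (0 : Fin 2) ((Pi.single w 1, 0) : mixedSpace K))) v = Complex.I • v)
    (hZ : gardingEnd hτ (Matrix.single (0 : Fin 2) (0 : Fin 2) ((Pi.single w 1, 0) : mixedSpace K)) v + gardingEnd hτ (Matrix.single (1 : Fin 2) (1 : Fin 2) ((Pi.single w 1, 0) : mixedSpace K)) v = μ • v)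
    (hC : (∑ i : Fin 2, ∑ j : Fin 2, gardingEnd hτ (Matrix.single i j ((Pi.single w 1, 0) : mixedSpace K)) (gardingEnd hτ (Matrix.single j i ((Pi.single w 1, 0) : mixedSpace K)) v)) = lam • v) :
    κ.re = 0 := by
  have h := inner_lowering_self_weightOne hτ w hτu μ lam v hW hZ hC
  have hnormsq : ∀ x : E, ⟪x, x⟫_ℂ = ((‖x‖ ^ 2 : ℝ) : ℂ) := fun x => by
    rw [inner_self_eq_norm_sq_to_K]; norm_cast
  rw [hnormsq, hnormsq, ← hκ] at h
  have hvE : (v : E) ≠ 0 := fun h0 => hv0 (Subtype.ext h0)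
  have hv : (0 : ℝ) < ‖(v : E)‖ ^ 2 := by positivity
  have hv' : ((‖(v : E)‖ ^ 2 : ℝ) : ℂ) ≠ 0 := Complex.ofReal_ne_zero.mpr hv.ne'
  -- `(2κ)² = -‖L v‖² / ‖v‖²` is real `≤ 0`
  have hq : (2 * κ) ^ 2 = ((-(‖(((gardingEnd hτ ((Matrix.single (0 : Fin 2) (0 : Fin 2) ((Pi.single w 1, 0) : mixedSpace K)) - (Matrix.single (1 : Fin 2) (1 : Fin 2) ((Pi.single w 1, 0) : mixedSpace K)))
        - Complex.I • gardingEnd hτ ((Matrix.single (0 : Fin 2) (1 : Fin 2) ((Pi.single w 1, 0) : mixedSpace K)) + (Matrix.single (1 : Fin 2) (0 : Fin 2) ((Pi.single w 1, 0) : mixedSpace K)))) v : archGardingSpace hcpt τ) : E)‖ ^ 2 / ‖(v : E)‖ ^ 2) : ℝ) : ℂ) := by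
    have e : ((‖(((gardingEnd hτ ((Matrix.single (0 : Fin 2) (0 : Fin 2) ((Pi.single w 1, 0) : mixedSpace K)) - (Matrix.single (1 : Fin 2) (1 : Fin 2) ((Pi.single w 1, 0) : mixedSpace K)))
        - Complex.I • gardingEnd hτ ((Matrix.single (0 : Fin 2) (1 : Fin 2) ((Pi.single w 1, 0) : mixedSpace K)) + (Matrix.single (1 : Fin 2) (0 : Fin 2) ((Pi.single w 1, 0) : mixedSpace K)))) v : archGardingSpace hcpt τ) : E)‖ ^ 2 : ℝ) : ℂ) / ((‖(v : E)‖ ^ 2 : ℝ) : ℂ) = -((2 * κ) ^ 2) := by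
      rw [div_eq_iff hv', h]
    have e' : (2 * κ) ^ 2 = -(((‖(((gardingEnd hτ ((Matrix.single (0 : Fin 2) (0 : Fin 2) ((Pi.single w 1, 0) : mixedSpace K)) - (Matrix.single (1 : Fin 2) (1 : Fin 2) ((Pi.single w 1, 0) : mixedSpace K)))
        - Complex.I • gardingEnd hτ ((Matrix.single (0 : Fin 2) (1 : Fin 2) ((Pi.single w 1, 0) : mixedSpace K)) + (Matrix.single (1 : Fin 2) (0 : Fin 2) ((Pi.single w 1, 0) : mixedSpace K)))) v : archGardingSpace hcpt τ) : E)‖ ^ 2 : ℝ) : ℂ) / ((‖(v : E)‖ ^ 2 : ℝ) : ℂ)) := by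
      rw [e, neg_neg]
    rw [e']
    push_cast
    ring
  -- a complex number whose square is real `≤ 0` is purely imaginary
  have him : ((2 * κ) ^ 2).im = 0 := by rw [hq, Complex.ofReal_im]
  have hre : ((2 * κ) ^ 2).re ≤ 0 := by
    rw [hq, Complex.ofReal_re, neg_nonpos]
    positivity
  simp only [sq, Complex.mul_im, Complex.mul_re, Complex.re_ofNat, Complex.im_ofNat, zero_mul, sub_zero, add_zero] at him hre
  have h1 : κ.re * κ.im = 0 := by nlinarith
  rcases mul_eq_zero.mp h1 with h0 | h0
  · exact h0
  · rw [h0] at hre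
    nlinarith [sq_nonneg κ.re]

end RealPlace

end Literature.NumberTheory.Automorphic
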